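import Summits.Ventures.DiscreteObjects.Hadamard.PAFParityTools

/-!
# Legendre pairs of length 333: the two sequences never have equal 3-compression norms (kernel) — hence no LP(333) has
# `PAF_b = PAF_a ∘ (unit)`

Framing: lottery ticket; floor = certified bounds/negative ranges.

Cell pub-namedobj (venture DiscreteObjects), target (H), hadamard gen 20.  For a `±1` sequence `c` of length `333` write
`N₃(c) := Σ_{3 ∣ s} PAF_c(s) = c̃₀² + c̃₁² + c̃₂²` (the norm of the 3-compression; `NineComp333.sum_sq_cs3`, after
[Đoković–Kotsireas 2015, Thm 3]).  Each class sum `c̃_k` is a sum of `111` signs, hence ODD, so **`N₃(c) ≡ 3 (mod 8)`**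
(`compNorm3_mod8`).  For a Legendre pair `(a, b)` of length 333 the norm identity gives `N₃(a) + N₃(b) = 446`
(`NineComp333.sum_theta_paf`, RHdQ 2026 Lemma 2/4); equal norms would force `N₃(a) = 223 ≡ 7 (mod 8)` — impossible:
**`legendrePair333_compNorm3_ne`**.  (Spectrally: `|A(ω)|² = |B(ω)|² = 334 = 2·167` at a primitive cube root of unity `ω` is not an
Eisenstein norm; the parity form avoids the DFT.)  Corollary **`legendrePair333_paf_twist_ne`**: there is no unit `u` of `ZMod 333` with
`PAF_b(u·s) = PAF_a(s)` for all `s ≠ 0` (multiplication by a unit permutes the multiples of `3`), generalising gen 19's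
`legendrePair333_paf_ne` (`u = 1`).  This is the Legendre-pair input for the 'mixed case' of the order-333 normaliser theorem
(`Order333Normalizer668`: an automorphism normalising the order-333 element cannot preserve the row cores while exchanging the column
cores).  Ours (elementary; not found in print as stated — the ingredients are the compression identities of DK 2015 / RHdQ 2026);
no `sorry`, no definitions, no `native_decide`.
-/

namespace Summit.Ventures.DiscreteObjects.Hadamard

open Finset BigOperators

open Literature.Combinatorics.Designs.LegendrePairs (PAF IsPM LegendrePair paf_zero)
open Literature.Combinatorics.Designs.LegendrePairs.NineComp333 (χ cs sum_sq_cs3 sum_theta_paf val_mul_mod)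

set_option maxRecDepth 16384

/-- each residue class mod `3` of `ZMod 333` has `111` elements -/
lemma card_class3_333 (k : ℕ) (hk : k < 3) : ∑ i : ZMod 333, χ 3 k i = 111 := by
  unfold χ
  interval_cases k <;> decide

/-- the mod-3 class sums of a `±1` sequence of length `333` are odd (`111` terms each) -/
lemma cs3_odd (c : ZMod 333 → ℤ) (hc : IsPM c) (k : ℕ) (hk : k < 3) : Odd (cs 3 c k) := by
  have hsplit : cs 3 c k = ∑ i, χ 3 k i * (c i - 1) + ∑ i, χ 3 k i := by
    unfold cs; rw [← Finset.sum_add_distrib]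
    refine Finset.sum_congr rfl fun i _ => ?_; ring
  have heven : (2 : ℤ) ∣ ∑ i : ZMod 333, χ 3 k i * (c i - 1) :=
    Finset.dvd_sum fun i _ => by
      rcases hc i with h | h
      · rw [h]; simp
      · rw [h]; exact Dvd.dvd.mul_left (by norm_num) _
  rw [hsplit, card_class3_333 k hk]
  obtain ⟨m, hm⟩ := heven
  exact ⟨m + 55, by rw [hm]; ring⟩

/-- the square of an odd integer is `1 (mod 8)` -/
lemma odd_sq_mod_eight (x : ℤ) (hx : Odd x) : ∃ k : ℤ, x ^ 2 = 8 * k + 1 := by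
  obtain ⟨m, rfl⟩ := hx
  obtain ⟨j, hj⟩ := Int.even_mul_succ_self m
  exact ⟨j, by nlinarith [hj]⟩

/-- **the 3-compression norm of a `±1` sequence of length `333` is `≡ 3 (mod 8)`**: `Σ_{3 ∣ s} PAF_c(s) = c̃₀² + c̃₁² + c̃₂²` with
all three class sums odd. -/
theorem compNorm3_mod8 (c : ZMod 333 → ℤ) (hc : IsPM c) : ∃ k : ℤ, ∑ s, χ 3 0 s * PAF c s = 8 * k + 3 := by
  rw [← sum_sq_cs3]
  simp only [Finset.sum_range_succ, Finset.sum_range_zero, zero_add]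
  obtain ⟨k₀, h₀⟩ := odd_sq_mod_eight _ (cs3_odd c hc 0 (by norm_num))
  obtain ⟨k₁, h₁⟩ := odd_sq_mod_eight _ (cs3_odd c hc 1 (by norm_num))
  obtain ⟨k₂, h₂⟩ := odd_sq_mod_eight _ (cs3_odd c hc 2 (by norm_num))
  exact ⟨k₀ + k₁ + k₂, by rw [h₀, h₁, h₂]; ring⟩

/-- **The two sequences of a Legendre pair of length `333` have different 3-compression norms**: `N₃(a) + N₃(b) = 446` and
`N₃ ≡ 3 (mod 8)` on both sides, so `N₃(a) = N₃(b) = 223 ≡ 7 (mod 8)` is impossible. -/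
theorem legendrePair333_compNorm3_ne (a b : ZMod 333 → ℤ) (hL : LegendrePair a b) :
    ∑ s, χ 3 0 s * PAF a s ≠ ∑ s, χ 3 0 s * PAF b s := by
  intro heq
  have h446 := sum_theta_paf a b hL
  have hsplit : ∑ s, χ 3 0 s * (PAF a s + PAF b s) = ∑ s, χ 3 0 s * PAF a s + ∑ s, χ 3 0 s * PAF b s := by
    rw [← Finset.sum_add_distrib]
    refine Finset.sum_congr rfl fun s _ => ?_; ring
  obtain ⟨k, hk⟩ := compNorm3_mod8 a hL.1
  omega

/-- multiplication by a unit preserves the class of multiples of `3` in `ZMod 333` -/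
lemma chi3_zero_unit_mul (u : (ZMod 333)ˣ) (s : ZMod 333) : χ 3 0 ((u : ZMod 333) * s) = χ 3 0 s := by
  have hcop : Nat.Coprime (u : ZMod 333).val 333 := ZMod.val_coe_unit_coprime u
  have h3 : Nat.Coprime (u : ZMod 333).val 3 := hcop.coprime_dvd_right (by norm_num)
  have hnd : ¬ 3 ∣ (u : ZMod 333).val := fun h => by
    have h1 : 3 ∣ Nat.gcd (u : ZMod 333).val 3 := Nat.dvd_gcd h (dvd_refl 3)
    rw [Nat.Coprime.gcd_eq_one h3] at h1
    omega
  have hmul := val_mul_mod (by decide : 3 ∣ 333) (u : ZMod 333) s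
  unfold χ
  rw [hmul]
  by_cases hs : s.val % 3 = 0
  · rw [if_pos hs, if_pos]
    exact Nat.mod_eq_zero_of_dvd (Dvd.dvd.mul_left (Nat.dvd_of_mod_eq_zero hs) _)
  · rw [if_neg hs, if_neg]
    intro h0
    have h3dvd : 3 ∣ (u : ZMod 333).val * s.val := Nat.dvd_of_mod_eq_zero h0
    rcases (Nat.Prime.dvd_mul (by norm_num : Nat.Prime 3)).mp h3dvd with h | h
    · exact hnd h
    · exact hs (Nat.mod_eq_zero_of_dvd h)

/-- **No Legendre pair of length `333` has `PAF_b(u·s) = PAF_a(s)` (`s ≠ 0`) for a unit `u`** — the autocorrelations of the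
second sequence are never a multiplier-twist of those of the first (the case `u = 1` is gen 19's `legendrePair333_paf_ne`). -/
theorem legendrePair333_paf_twist_ne (a b : ZMod 333 → ℤ) (hL : LegendrePair a b) (u : (ZMod 333)ˣ)
    (h : ∀ s : ZMod 333, s ≠ 0 → PAF b ((u : ZMod 333) * s) = PAF a s) : False := by
  apply legendrePair333_compNorm3_ne a b hL
  symm
  calc ∑ s, χ 3 0 s * PAF b s = ∑ s, χ 3 0 ((u : ZMod 333) * s) * PAF b ((u : ZMod 333) * s) :=
        (Equiv.sum_comp u.mulLeft (fun s => χ 3 0 s * PAF b s)).symm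
    _ = ∑ s, χ 3 0 s * PAF a s := by
        refine Finset.sum_congr rfl fun s _ => ?_
        rw [chi3_zero_unit_mul]
        by_cases hs : s = 0
        · subst hs; rw [mul_zero, paf_zero b hL.2.1, paf_zero a hL.1]
        · rw [h s hs]

/-- the same with the twist on the other side: `PAF_b(s) = PAF_a(u·s)` (`s ≠ 0`) is impossible as well -/
theorem legendrePair333_paf_twist_ne' (a b : ZMod 333 → ℤ) (hL : LegendrePair a b) (u : (ZMod 333)ˣ)
    (h : ∀ s : ZMod 333, s ≠ 0 → PAF b s = PAF a ((u : ZMod 333) * s)) : False := by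
  refine legendrePair333_paf_twist_ne a b hL u⁻¹ fun s hs => ?_
  have hs' : (↑u⁻¹ : ZMod 333) * s ≠ 0 := fun h0 => hs (by simpa using congrArg (fun z => (u : ZMod 333) * z) h0)
  rw [h _ hs', ← mul_assoc, Units.mul_inv, one_mul]

end Summit.Ventures.DiscreteObjects.Hadamard
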